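import Mathlib
import Summits.MatrixMultiplication.MatrixMultiplication.Theorems.SubgroupIdentityDesigns.Negative.TorusCube

/-!
# Unitriangular groups are invisible below level `#supp − 1` (negative lemma, crux `SubgroupIdentityDesigns`, 14079)

Level `k` on `M_m(𝔽_p)`: `f = Σ_{rk M ≤ k} c_M ψ(tr(M·))` (`fourierMat`).  Fix an index set `I ⊆ Fin m` and the
unitriangular pattern `Π_I = {(a,b) : b < a, a ∈ I, b ∈ I}` with pattern group `U_I = 1 + 𝔫_{Π_I}` (for an
interval `I` of length `n` this is a copy of the full lower unitriangular group `U_n(𝔽_p)`; `I = Fin m` gives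
`U_m(𝔽_p) ≤ GL_m(𝔽_p)` itself).  For a weight vector `c : Fin m → 𝔽_p` put the weight `c_b` on the
SUB-DIAGONAL pattern positions `(b+1, b)` (both indices in `I`) and let `ℓ_c(n) = Σ_b c_b n_{b+1,b}`; `ψ ∘ ℓ_c` is a
linear character of `U_I`, and its SUPPORT is `T(c) = {b : b, b+1 ∈ I, c_b ≠ 0}`.
* `utSum_eq_zero`: `Σ_{u ∈ U_I} ψ(ℓ_c(u)) ψ(tr(M u)) = 0` for every `M` with `rk M < #T(c)` — the sum over the affine
  space `U_I` factorises as `ψ(tr M) · Π_{(a,b) ∈ Π_I} p·[M_{ba} = −(weight at (a,b))]`, and on the support of that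
  product the `#T × #T` submatrix of `M` with rows `T` and columns `T + 1` is lower triangular with diagonal `−c ≠ 0`
  (`card_utSupp_le_rank`);
* `ut_fourierMat_sum_eq_zero`, `no_idTest_of_unitriangular`: hence no level-`k` function is `1` at `1` and `0` on
  the rest of a set `S ⊆ M_m(𝔽_p)` containing `U_I` as soon as `k < #T(c)` for some `c`, i.e. as soon as `I`
  contains `k + 2` consecutive indices; `no_levelK_design_of_unitriangular`: in `GL_m(𝔽_p)` with `k + 2 ≤ m`, a
  subgroup triple whose `H₁` contains the lower unitriangular group `U_m(𝔽_p)` admits NO level-`k` identity design,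
  whatever `H₂, H₃` are (no TPP needed, any prime `p`).
In representation-theoretic terms (cell B2b-5 gen 2, `run/shared/lean/b2b/levelgraded-cu/ORACLE-g2.md` §G3,
Lemma 1): a linear character of `U_n(𝔽_p)` with `s` non-zero simple-root coordinates does not occur in the
permutation module `ℂ[M_{n×r}(𝔽_p)]` for `r < s` (equivalently, by Frobenius reciprocity and Gurevich–Howe,
generic irreducibles of `GL_n(𝔽_p)` have strict tensor rank `≥ n − 1`); the converse (`r ≥ s` suffices) and the
statement that every NON-linear irreducible of `U_n` already occurs at `r = n − 2` are proved on paper there and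
certified numerically, not here.  `Negative.RootSmear[Weighted]` is the analogous statement for the mixed
pattern `Π(k,i,j)` of the Borel template.  Sorry-free; standard axioms.
-/

set_option linter.dupNamespace false

noncomputable section

open scoped BigOperators Classical

namespace Summit.MatrixMultiplication.MatrixMultiplication.Theorems.SubgroupIdentityDesigns.Negative

variable {p m : ℕ} [Fact p.Prime]

/-- The unitriangular pattern on the index set `I`: positions `(a, b)` with `b < a`, `a, b ∈ I`. -/
def utPat (I : Finset (Fin m)) : Finset (Fin m × Fin m) :=
  Finset.univ.filter fun ab => ab.2 < ab.1 ∧ ab.1 ∈ I ∧ ab.2 ∈ I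

/-- Unfolding membership in `Π_I`. -/
theorem mem_utPat {I : Finset (Fin m)} {a b : Fin m} : (a, b) ∈ utPat I ↔ b < a ∧ a ∈ I ∧ b ∈ I := by
  simp [utPat]

/-- The pattern entries read off `e` (else `0`): the nilpotent part `n_e` of the point `1 + n_e ∈ U_I`. -/
def utNil (I : Finset (Fin m)) (e : CMat p m) : CMat p m :=
  Matrix.of fun a b => if (a, b) ∈ utPat I then e a b else 0

/-- The weight table: `c_b` at the sub-diagonal pattern positions `(b+1, b)`, `0` elsewhere. -/
def utEps (I : Finset (Fin m)) (c : Fin m → ZMod p) (a b : Fin m) : ZMod p :=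
  if (a, b) ∈ utPat I ∧ a.val = b.val + 1 then c b else 0

/-- The linear form `ℓ_c(n_e) = Σ_{(b,a)} (weight at (b,a)) · e_{ba}` (outer index the column). -/
def utEll (I : Finset (Fin m)) (c : Fin m → ZMod p) (e : CMat p m) : ZMod p :=
  ∑ a : Fin m, ∑ b : Fin m, utEps I c b a * e b a

/-- The support `T(c) = {b : b ∈ I, b+1 ∈ I, c_b ≠ 0}` of the character `ψ ∘ ℓ_c`. -/
def utSupp (I : Finset (Fin m)) (c : Fin m → ZMod p) : Finset (Fin m) :=
  Finset.univ.filter fun b => ∃ h : b.val + 1 < m, (⟨b.val + 1, h⟩ : Fin m) ∈ I ∧ b ∈ I ∧ c b ≠ 0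

/-- Unfolding membership in the support. -/
theorem mem_utSupp {I : Finset (Fin m)} {c : Fin m → ZMod p} {b : Fin m} :
    b ∈ utSupp I c ↔ ∃ h : b.val + 1 < m, (⟨b.val + 1, h⟩ : Fin m) ∈ I ∧ b ∈ I ∧ c b ≠ 0 := by
  simp [utSupp]

/-- The weight table vanishes off the pattern. -/
theorem utEps_eq_zero_of_not_mem {I : Finset (Fin m)} (c : Fin m → ZMod p) {a b : Fin m}
    (h : (a, b) ∉ utPat I) : utEps I c a b = 0 := by
  unfold utEps
  rw [if_neg (fun hh => h hh.1)]

/-- The trace of `M (1 + n_e)`: `tr M` plus the pattern entries. -/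
theorem trace_mul_one_add_utNil (I : Finset (Fin m)) (e M : CMat p m) :
    Matrix.trace (M * (1 + utNil I e)) =
      (∑ a : Fin m, M a a) +
        ∑ a : Fin m, ∑ b : Fin m, (if (b, a) ∈ utPat I then M a b * e b a else 0) := by
  rw [Matrix.mul_add, Matrix.mul_one, Matrix.trace_add]
  congr 1
  simp only [Matrix.trace, Matrix.diag_apply, Matrix.mul_apply, utNil, Matrix.of_apply]
  refine Finset.sum_congr rfl fun a _ => Finset.sum_congr rfl fun b _ => ?_
  split_ifs <;> simp

/-- The twisted phase of one point factorises over the pattern entries. -/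
theorem ut_phase (I : Finset (Fin m)) (c : Fin m → ZMod p) (e M : CMat p m) :
    ZMod.stdAddChar (utEll I c e) * ZMod.stdAddChar (Matrix.trace (M * (1 + utNil I e))) =
      ZMod.stdAddChar (∑ a : Fin m, M a a) *
        ∏ a : Fin m, ∏ b : Fin m,
          ZMod.stdAddChar (if (b, a) ∈ utPat I then (M a b + utEps I c b a) * e b a else 0) := by
  have hsum : utEll I c e + ∑ a : Fin m, ∑ b : Fin m, (if (b, a) ∈ utPat I then M a b * e b a else 0)
      = ∑ a : Fin m, ∑ b : Fin m,
          (if (b, a) ∈ utPat I then (M a b + utEps I c b a) * e b a else 0) := by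
    unfold utEll
    rw [← Finset.sum_add_distrib]
    refine Finset.sum_congr rfl fun a _ => ?_
    rw [← Finset.sum_add_distrib]
    refine Finset.sum_congr rfl fun b _ => ?_
    by_cases hl : (b, a) ∈ utPat I
    · rw [if_pos hl, if_pos hl]
      ring
    · rw [if_neg hl, if_neg hl, utEps_eq_zero_of_not_mem c hl]
      ring
  rw [trace_mul_one_add_utNil, AddChar.map_add_eq_mul, mul_left_comm, ← AddChar.map_add_eq_mul, hsum]
  congr 1
  rw [stdAddChar_map_sum]
  exact Finset.prod_congr rfl fun a _ => stdAddChar_map_sum (p := p) Finset.univ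
    (fun b => if (b, a) ∈ utPat I then (M a b + utEps I c b a) * e b a else 0)

/-- **Summing over the pattern group**: `Σ_e ψ(ℓ_c(n_e)) ψ(tr(M(1+n_e))) = ψ(tr M) · Π_{(b,a)} w_{ab}` with
`w = p·[M_ab + (weight at (b,a)) = 0]` on pattern positions `(b,a)` and `w = p` elsewhere. -/
theorem sum_ut_phase (I : Finset (Fin m)) (c : Fin m → ZMod p) (M : CMat p m) :
    ∑ e : CMat p m, ZMod.stdAddChar (utEll I c e) *
        ZMod.stdAddChar (Matrix.trace (M * (1 + utNil I e))) =
      ZMod.stdAddChar (∑ a : Fin m, M a a) *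
        ∏ a : Fin m, ∏ b : Fin m,
          (if (b, a) ∈ utPat I then (if M a b + utEps I c b a = 0 then (p : ℂ) else 0) else (p : ℂ)) := by
  simp_rw [ut_phase]
  rw [← Finset.mul_sum]
  congr 1
  set G : Fin m → Fin m → ZMod p → ℂ := fun a b x =>
    ZMod.stdAddChar (if (b, a) ∈ utPat I then (M a b + utEps I c b a) * x else 0) with hG
  have hswap : (∑ e : CMat p m, ∏ a : Fin m, ∏ b : Fin m, G a b (e b a)) =
      ∏ a : Fin m, ∏ b : Fin m, ∑ x : ZMod p, G a b x := by
    calc (∑ e : CMat p m, ∏ a : Fin m, ∏ b : Fin m, G a b (e b a))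
        = ∑ e : CMat p m, ∏ b : Fin m, ∏ a : Fin m, G a b (e b a) := by
          refine Finset.sum_congr rfl fun e _ => Finset.prod_comm
      _ = ∑ f : Fin m → Fin m → ZMod p, ∏ b : Fin m, ∏ a : Fin m, G a b (f b a) := by
          rw [← Equiv.sum_comp Matrix.of]
          rfl
      _ = ∏ b : Fin m, ∑ g : Fin m → ZMod p, ∏ a : Fin m, G a b (g a) :=
          (Fintype.prod_sum (fun b (g : Fin m → ZMod p) => ∏ a : Fin m, G a b (g a))).symm
      _ = ∏ b : Fin m, ∏ a : Fin m, ∑ x : ZMod p, G a b x := by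
          refine Finset.prod_congr rfl fun b _ => ?_
          exact (Fintype.prod_sum (fun a (x : ZMod p) => G a b x)).symm
      _ = _ := Finset.prod_comm
  have hG' : ∀ (e : CMat p m) (a b : Fin m),
      ZMod.stdAddChar (if (b, a) ∈ utPat I then (M a b + utEps I c b a) * e b a else 0) = G a b (e b a) :=
    fun e a b => rfl
  simp_rw [hG']
  rw [hswap]
  refine Finset.prod_congr rfl fun a _ => Finset.prod_congr rfl fun b _ => ?_
  by_cases hc : (b, a) ∈ utPat I
  · simp only [hG, if_pos hc]
    rw [sum_psi_mul]
  · simp only [hG, if_neg hc, AddChar.map_zero_eq_one, Finset.sum_const, Finset.card_univ, ZMod.card,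
      nsmul_eq_mul, mul_one]

/-- The rank step: if `M_{ab} = −(weight at (b,a))` at every pattern position `(b,a)`, then `rk M ≥ #T(c)`:
the submatrix with rows `T(c)` and columns `T(c) + 1` is lower triangular with diagonal entries `−c_b ≠ 0`. -/
theorem card_utSupp_le_rank (I : Finset (Fin m)) (c : Fin m → ZMod p) (M : CMat p m)
    (hent : ∀ a b : Fin m, (b, a) ∈ utPat I → M a b = -utEps I c b a) :
    (utSupp I c).card ≤ M.rank := by
  set s := (utSupp I c).card with hs
  -- index maps of the `s × s` minor
  let row : Fin s → Fin m := fun r => (utSupp I c).orderEmbOfFin hs.symm r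
  have hrowmem : ∀ r : Fin s, row r ∈ utSupp I c := fun r => Finset.orderEmbOfFin_mem _ _ r
  have hrowlt : ∀ r : Fin s, (row r).val + 1 < m := fun r => (mem_utSupp.1 (hrowmem r)).1
  let col : Fin s → Fin m := fun r => ⟨(row r).val + 1, hrowlt r⟩
  let S : Matrix (Fin s) (Fin s) (ZMod p) := M.submatrix row col
  -- entries on and above the diagonal: zero above, `-c ≠ 0` on the diagonal
  have hS : ∀ r q : Fin s, r ≤ q → (r ≠ q → S r q = 0) ∧ (r = q → S r q ≠ 0) := by
    intro r q hrq
    show (r ≠ q → M (row r) (col q) = 0) ∧ (r = q → M (row r) (col q) ≠ 0)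
    have hle : row r ≤ row q := ((utSupp I c).orderEmbOfFin hs.symm).le_iff_le.2 hrq
    obtain ⟨hq1, hqI1, hqI, hqc⟩ := mem_utSupp.1 (hrowmem q)
    obtain ⟨hr1, hrI1, hrI, hrc⟩ := mem_utSupp.1 (hrowmem r)
    have hpat : (col q, row r) ∈ utPat I := by
      refine mem_utPat.2 ⟨?_, hqI1, hrI⟩
      show (row r).val < (row q).val + 1
      exact Nat.lt_succ_of_le hle
    rw [hent _ _ hpat]
    unfold utEps
    refine ⟨fun hne => ?_, fun heq => ?_⟩
    · rw [if_neg, neg_zero]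
      rintro ⟨_, h2⟩
      apply hne
      change (row q).val + 1 = (row r).val + 1 at h2
      have : row q = row r := Fin.ext (by omega)
      exact (((utSupp I c).orderEmbOfFin hs.symm).injective this).symm
    · subst heq
      rw [if_pos ⟨hpat, rfl⟩]
      exact neg_ne_zero.2 hrc
  have htri : S.BlockTriangular OrderDual.toDual := by
    intro r q hlt
    have hlt' : r < q := by simpa using hlt
    exact (hS r q (le_of_lt hlt')).1 (ne_of_lt hlt')
  have hdet : S.det ≠ 0 := by
    rw [Matrix.det_of_lowerTriangular S htri]
    exact Finset.prod_ne_zero_iff.2 fun r _ => (hS r r le_rfl).2 rfl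
  have hunit : IsUnit S := (Matrix.isUnit_iff_isUnit_det _).2 (isUnit_iff_ne_zero.2 hdet)
  have hrank : S.rank = s := by
    rw [Matrix.rank_of_isUnit _ hunit, Fintype.card_fin]
  calc s = S.rank := hrank.symm
    _ ≤ M.rank := Matrix.rank_submatrix_le M row col

/-- **THE CHARACTER SUM OVER `U_I` VANISHES BELOW LEVEL `#T(c)`.** For every `M` with `rk M < #T(c)`:
`Σ_e ψ(ℓ_c(n_e)) ψ(tr(M (1 + n_e))) = 0`. -/
theorem utSum_eq_zero (I : Finset (Fin m)) (c : Fin m → ZMod p) (M : CMat p m)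
    (hM : M.rank < (utSupp I c).card) :
    ∑ e : CMat p m, ZMod.stdAddChar (utEll I c e) *
        ZMod.stdAddChar (Matrix.trace (M * (1 + utNil I e))) = 0 := by
  rw [sum_ut_phase]
  by_contra hne
  have hent : ∀ a b : Fin m, (b, a) ∈ utPat I → M a b = -utEps I c b a := by
    intro a b hp
    have hzero : M a b + utEps I c b a = 0 := by
      by_contra hM'
      apply hne
      apply mul_eq_zero_of_right
      apply Finset.prod_eq_zero (Finset.mem_univ a)
      apply Finset.prod_eq_zero (Finset.mem_univ b)
      rw [if_pos hp, if_neg hM']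
    exact eq_neg_of_add_eq_zero_left hzero
  have := card_utSupp_le_rank I c M hent
  omega

/-- **The `ℓ_c`-twisted sum of a level-`k` function over `U_I` vanishes whenever `k < #T(c)`.** -/
theorem ut_fourierMat_sum_eq_zero (I : Finset (Fin m)) (c : Fin m → ZMod p) (k : ℕ)
    (hk : k < (utSupp I c).card) (f : CMat p m → ℂ) (hf : ∀ M : CMat p m, k < M.rank → f M = 0) :
    ∑ e : CMat p m, ZMod.stdAddChar (utEll I c e) * fourierMat f (1 + utNil I e) = 0 := by
  unfold fourierMat
  simp_rw [Finset.mul_sum]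
  rw [Finset.sum_comm]
  refine Finset.sum_eq_zero fun M _ => ?_
  have : ∀ e : CMat p m, ZMod.stdAddChar (utEll I c e) *
      (f M * ZMod.stdAddChar (Matrix.trace (M * (1 + utNil I e)))) =
      f M * (ZMod.stdAddChar (utEll I c e) *
        ZMod.stdAddChar (Matrix.trace (M * (1 + utNil I e)))) := fun e => by ring
  simp_rw [this]
  rw [← Finset.mul_sum]
  by_cases hr : M.rank ≤ k
  · rw [utSum_eq_zero I c M (by omega), mul_zero]
  · rw [hf M (by omega), zero_mul]

/-- **NO LEVEL-`k` IDENTITY TEST ON A SET CONTAINING `U_I`** as soon as some sub-diagonal character of `U_I`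
has more than `k` non-zero coordinates. -/
theorem no_idTest_of_unitriangular (I : Finset (Fin m)) (c : Fin m → ZMod p) (k : ℕ)
    (hk : k < (utSupp I c).card) (S : Set (CMat p m)) (hS : ∀ e : CMat p m, 1 + utNil I e ∈ S)
    (f : CMat p m → ℂ) (hf : ∀ M : CMat p m, k < M.rank → f M = 0)
    (h1 : fourierMat f 1 = 1) (h0 : ∀ s ∈ S, s ≠ 1 → fourierMat f s = 0) : False := by
  have hsum := ut_fourierMat_sum_eq_zero I c k hk f hf
  -- each term is `[n_e = 0]`
  have hval : ∀ e : CMat p m, ZMod.stdAddChar (utEll I c e) * fourierMat f (1 + utNil I e) =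
      if utNil I e = 0 then 1 else 0 := by
    intro e
    by_cases he : utNil I e = 0
    · have hℓ : utEll I c e = 0 := by
        unfold utEll
        refine Finset.sum_eq_zero fun a _ => Finset.sum_eq_zero fun b _ => ?_
        by_cases hl : (b, a) ∈ utPat I
        · have := congrFun (congrFun he b) a
          simp only [utNil, Matrix.of_apply, if_pos hl, Matrix.zero_apply] at this
          rw [this, mul_zero]
        · rw [utEps_eq_zero_of_not_mem c hl, zero_mul]
      rw [if_pos he, he, add_zero, hℓ, AddChar.map_zero_eq_one, h1, one_mul]
    · have hne1 : (1 : CMat p m) + utNil I e ≠ 1 := fun h => he (by simpa using h)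
      rw [if_neg he, h0 _ (hS e) hne1, mul_zero]
  simp_rw [hval] at hsum
  rw [Finset.sum_ite, Finset.sum_const_zero, add_zero, Finset.sum_const, nsmul_eq_mul, mul_one] at hsum
  have hpos : 0 < (Finset.univ.filter fun e : CMat p m => utNil I e = 0).card :=
    Finset.card_pos.2 ⟨0, by simp [utNil]; rfl⟩
  exact absurd hsum (Nat.cast_ne_zero.2 hpos.ne')

/-- `1 + n_e` is unitriangular, hence invertible. -/
theorem det_one_add_utNil (I : Finset (Fin m)) (e : CMat p m) : (1 + utNil I e).det = 1 := by
  have htri : (1 + utNil I e).BlockTriangular OrderDual.toDual := by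
    intro a b hlt
    have hlt' : a < b := by simpa using hlt
    have hne : a ≠ b := ne_of_lt hlt'
    have hnot : (a, b) ∉ utPat I := fun h => lt_asymm hlt' (mem_utPat.1 h).1
    simp [Matrix.add_apply, utNil, hne, hnot]
  rw [Matrix.det_of_lowerTriangular _ htri]
  refine Finset.prod_eq_one fun a _ => ?_
  have hnot : (a, a) ∉ utPat I := fun h => lt_irrefl _ (mem_utPat.1 h).1
  simp [Matrix.add_apply, utNil, hnot]

/-- For the full index set and all weights `1`, the support is `{b : b + 1 < m}`, of size at least `k + 1`
whenever `k + 2 ≤ m`. -/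
theorem lt_card_utSupp_univ (k : ℕ) (hkm : k + 2 ≤ m) :
    k < (utSupp (Finset.univ : Finset (Fin m)) (fun _ => (1 : ZMod p))).card := by
  let ι : Fin (k + 1) → Fin m := fun t => ⟨t.val, by omega⟩
  have hinj : Function.Injective ι := fun t t' h => Fin.ext (by simpa [ι] using congrArg Fin.val h)
  have hsub : Finset.univ.image ι ⊆ utSupp (Finset.univ : Finset (Fin m)) (fun _ => (1 : ZMod p)) := by
    intro x hx
    rcases Finset.mem_image.1 hx with ⟨t, _, rfl⟩
    refine mem_utSupp.2 ⟨by simp [ι]; omega, Finset.mem_univ _, Finset.mem_univ _, one_ne_zero⟩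
  calc k < (Finset.univ.image ι).card := by
        rw [Finset.card_image_of_injective _ hinj, Finset.card_univ, Fintype.card_fin]; omega
    _ ≤ _ := Finset.card_le_card hsub

/-- **DESIGN FILTER (unitriangular).** In `GL_m(𝔽_p)` with `k + 2 ≤ m`: if `H₁` contains every lower
unitriangular matrix, then `(H₁, H₂, H₃)` admits NO level-`k` identity design (the crux's Fourier clause),
whatever `H₂, H₃` are.  No TPP is needed; any prime `p`. -/
theorem no_levelK_design_of_unitriangular (k : ℕ) (hkm : k + 2 ≤ m)
    {H₁ H₂ H₃ : Subgroup (Matrix.GeneralLinearGroup (Fin m) (ZMod p))}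
    (hU : ∀ u : Matrix.GeneralLinearGroup (Fin m) (ZMod p),
      (∀ a b : Fin m, ((u : CMat p m) - 1) a b ≠ 0 → b < a) → u ∈ H₁)
    (hid : ∃ c : CMat p m → ℂ, (∀ M : CMat p m, k < M.rank → c M = 0) ∧
      (∑ M : CMat p m, c M * ZMod.stdAddChar (Matrix.trace
        (M * ((1 : Matrix.GeneralLinearGroup (Fin m) (ZMod p)) : CMat p m)))) = 1 ∧
      ∀ a ∈ H₁, ∀ b ∈ H₂, ∀ g ∈ H₃, a * b * g ≠ 1 →
        (∑ M : CMat p m, c M * ZMod.stdAddChar (Matrix.trace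
          (M * ((a * b * g : Matrix.GeneralLinearGroup (Fin m) (ZMod p)) : CMat p m)))) = 0) :
    False := by
  obtain ⟨c, hc, h1, h0⟩ := hid
  let S : Set (CMat p m) := {s | ∃ a ∈ H₁, ∃ b ∈ H₂, ∃ g ∈ H₃,
    s = ((a * b * g : Matrix.GeneralLinearGroup (Fin m) (ZMod p)) : CMat p m)}
  refine no_idTest_of_unitriangular (Finset.univ : Finset (Fin m)) (fun _ => (1 : ZMod p)) k
    (lt_card_utSupp_univ k hkm) S ?_ c hc ?_ ?_
  · intro e
    let u : Matrix.GeneralLinearGroup (Fin m) (ZMod p) :=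
      Matrix.GeneralLinearGroup.mkOfDetNeZero (1 + utNil Finset.univ e)
        (by rw [det_one_add_utNil]; exact one_ne_zero)
    have hu : (u : CMat p m) = 1 + utNil Finset.univ e := rfl
    have huH : u ∈ H₁ := by
      refine hU u fun a b hab => ?_
      rw [hu, add_sub_cancel_left] at hab
      simp only [utNil, Matrix.of_apply] at hab
      by_cases hcond : (a, b) ∈ utPat (Finset.univ : Finset (Fin m))
      · exact (mem_utPat.1 hcond).1
      · exact absurd (if_neg hcond) hab
    refine ⟨u, huH, 1, H₂.one_mem, 1, H₃.one_mem, ?_⟩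
    rw [mul_one, mul_one, hu]
  · simpa [fourierMat] using h1
  · rintro s ⟨a, ha, b, hb, g, hg, rfl⟩ hs
    refine h0 a ha b hb g hg fun h => hs ?_
    rw [h, Matrix.GeneralLinearGroup.coe_one]

end Summit.MatrixMultiplication.MatrixMultiplication.Theorems.SubgroupIdentityDesigns.Negative

end
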